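import Summits.QuantumFields.YangMills.Theorems.AllWindowsColdBoxBoxHighLineConnectedFourPointRows
import Summits.QuantumFields.YangMills.Theorems.AllWindowsColdBoxBoxHighLineConnectedFourPointEvenSlot
import Summits.QuantumFields.YangMills.Theorems.AllWindowsColdBoxBoxHighLineK4PrimeRowR2
import Summits.QuantumFields.YangMills.Theorems.AllWindowsColdBoxBoxHighLineCubicVertexTcRecord
import Summits.QuantumFields.YangMills.Theorems.AllWindowsColdBoxBoxHighLineAssemblyEpsTwoBudget

/-!
# U5 K4′ — the ROW SUM: `hK4` of ✓`landauThirdOrder_of_sizes₂` from the K4′ term table, GENERIC in the open rows R3, R4, R6/7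
# (planner ym-idea-2 g18 RULING 2026-08-30T01:00:27Z «hK4 ROW-SUM → w4 g30»; LEAD ym-line-sfw-p2 g78's `g78-K4PRIME-TERM-TABLE.md` and
# LETTERS OF RECORD 00:58:56Z; interface of record = w2 g33's `hKk` of ✓p753567; LINE-20 U5 ⟨stmt-QuantumFields-24336⟩ — U5 prep, helper-grade)

Extra width seat `ym-line-sfw-p2-w4` (g30).  The size `hK4` of the fourth cumulant `κ₄,₀^{μ_D}(c_x, c_y; tiltU, tiltU)` on every admissible symmetric
cut set `D`, in the currency of ✓`landauThirdOrder_of_sizes₂ (hK3) (hK4)`, is the SUM of the seven rows of LEAD's term table once the composition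
(S1)∘(S2)∘(S3) (`tiltU = Uᵒ + Uᵉ`, `Uᵒ = P + N′` with the cubic Taylor polynomial `P = β·Σ_p tripleForm (Tc p) (plaqVar_p)` FIRST, `c = L + Q`) has split
`κ₄,₀` into `κ₄(L_x,L_y;P)` (R1) `+ [κ₄(Q_x,c_y;P) + κ₄(L_x,Q_y;P)]` (R2) `+ κ₄(c_x,c_y;N′)` (R3) `+ 2·CROSS_P(c_x,c_y;P,N′)` (R4) `+ κ₄(c_x,c_y;Uᵉ)` (R5)
`+ 2·CROSS_{Uᵒ}(c_x,c_y;Uᵒ,Uᵉ)` (R6/7).  This file is the BOOKKEEPING of that sum and nothing else: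

* `K4RowSum.exists_tripleCoeff_record` — the cubic Taylor coefficients OF RECORD in LEAD's «P first» sign convention: bounded `Tc` (= minus the tensor of
  LEAD's ✓`EdgeChartGaussian.exists_Tc_record`, i.e. minus ✓7a's) with `|cubicVertex β H a + P a| ≤ Cr·β·H⁴·s⁵` on `smallField H s`;
* `K4RowSum.rowBound_R1` — row R1 in the per-row `hKk` currency, from LEAD's ✓`EdgeChartGaussian.abs_tiltCum4_muSet_cubicPair_le` (`q₁ := 1`, budgets
  `H⁸L⁷/β`, `H¹²L⁷β^{−3/2}` by ✓`AssemblyBudget.budget_monomial`);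
* `K4RowSum.rowBound_R2` — row R2 in the per-row `hKk` currency, from w5 g24's ✓`GaussNormalForm.abs_tiltCum4_muSet_rowR2_sum_le_rpow` (`q₂ := 0`,
  budget `H¹²L⁴β^{−3/2+(3/2)κ₃}`, row `93θ/8 < 21/16`);
* `K4RowSum.rowBound_R5` — row R5 in the per-row `hKk` currency, from LEAD's ✓`GaussNormalForm.abs_tiltCum4_muSet_chartPlaqCost_tiltUEven_le` (side
  conditions by ✓`AssemblyBudget.side_budget`; budgets `H¹⁶s⁴`, `H²⁰s¹⁰β²`, `H¹⁶s¹²β²` — the first is the row (K6) `15θ < 3/2`, strict for every `θ < 1/10`);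
* ★★ `tiltCum4_cutSet_size_of_rows (hR3) (hR4) (hR67) : <w2's hK4 VERBATIM>` — LEAD's composition ✓`GaussNormalForm.abs_tiltCum4_muSet_tiltU_le_rows`
  (p754020: `|κ₄| ≤ R1 + |R2a + R2b| + R3 + 2·R4 + R5 + 2·R67`, CROSS terms in fcl-p3's ✓`tiltCum4_muSet_zero_add_third` output form, `P` resp. `Uᵒ` first)
  BY NAME, then `q := max qᵢ`, `K := Σ Kᵢ`, `ε/8` budgets.  The open rows enter as NAMED HYPOTHESES in the per-row `hKk` currency (for every `0 < θ < 1/10`,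
  with the record `(B, Tc)` — and for R3/R4 the quintic remainder constant `Cr` — fixed OUTSIDE `∃ q K`; TERMs = LEAD's rows token for token after `dsimp`):
  R3/R4 (w2 g33, `N′ := Uᵒ − P` as LEAD typed it), R6/7 (fcl-p3 g27's abstract CROSS-parity lemma + LEAD's by-name
  discharge, planner re-ruling 01:03:09Z) — each lands against its hypothesis by a short adapter (row statement → per-row `hKk`).

No definitions; tree only; standard axioms.  HONEST LABEL: CONDITIONAL bookkeeping (helper-grade prep) for the UNSTAFFED stub U5 — `hK4` is NOT proved
here (rows R3, R4, R6/7 are hypotheses); U5 `stub_landauThirdOrder`, ⟨24336⟩, ⟨24004⟩ and this seat's crux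
⟨stmt-QuantumFields-22884⟩ remain OPEN; route AllWindowsColdBox is DRAFT; no crux, rung or summit is proved; **the Yang–Mills mass gap is NOT proved by
this file; no summit is proved by a line.**
-/

set_option autoImplicit false

noncomputable section

open MeasureTheory
open Literature.Probability.LatticeModels (Site)
open Literature.MathematicalPhysics.QuantumLattice (ZdPlaquette plaquettesTouching)
open Literature.MathematicalPhysics.QuantumFieldTheory.AxialGauge (boxEdges)
open Summit.QuantumFields.YangMills.Theorems.WeakCouplingRates (plaq12At)

namespace Summit.QuantumFields.YangMills.Theorems.AllWindowsColdBoxBoxHighLine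

namespace K4RowSum

open AssemblyBudget ErrorBudget

/-! ## The cubic Taylor coefficients of record («P first») -/

/-- ★ **The cubic Taylor coefficients OF RECORD in LEAD's «P first» sign convention**: a bounded tensor `Tc` (minus the tensor of
✓`EdgeChartGaussian.exists_Tc_record`, i.e. minus ✓7a's) with `|cubicVertex β H a + β·Σ_p tripleForm (Tc p) (plaqVar_p a)| ≤ Cr·β·H⁴·s⁵` on `smallField H s`
— so that `Uᵒ = P + N′` with `N′` small (sign glue ✓`EdgeChartGaussian.tripleFormSum_neg_left`). -/
theorem exists_tripleCoeff_record : ∃ B Cr : ℝ, 0 ≤ B ∧ 0 ≤ Cr ∧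
    ∃ Tc : ZdPlaquette 4 → Fin 4 → Fin 4 → Fin 4 → ℝ, (∀ p i j k, |Tc p i j k| ≤ B) ∧
      ∀ H : ℕ, 1 ≤ H → ∀ β : ℝ, 0 < β → ∀ s : ℝ, 0 ≤ s → ∀ a ∈ smallField H s,
        |cubicVertex β H a + β * ∑ p ∈ plaquettesTouching (boxEdges 4 (2 * H + 1)), tripleForm (Tc p) (plaqVar H p.1 p.2.1.1 p.2.1.2 a)| ≤
          Cr * β * (H : ℝ) ^ 4 * s ^ 5 := by
  obtain ⟨C, B, hC, hB, Tc, hT, hrec⟩ := EdgeChartGaussian.exists_Tc_record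
  refine ⟨B, C, hB, hC, fun p i j k => -Tc p i j k, fun p i j k => by rw [abs_neg]; exact hT p i j k, fun H hH β hβ s hs a ha => ?_⟩
  rw [EdgeChartGaussian.tripleFormSum_neg_left, ← sub_eq_add_neg]
  exact hrec H hH β hβ s hs a ha

/-! ## Rows R1 and R5 in the per-row `hKk` currency (by name) -/

/-- ★ **Row R1 (the exact cubic pair) in the per-row `hKk` currency**, from ✓`EdgeChartGaussian.abs_tiltCum4_muSet_cubicPair_le` (LEAD g78):
for the generic bounded `Tc`, `q₁ := 1`, `K₁ β H := C·B²·(1+log H)⁷·(1 + √(β⁻¹)·H⁴)/β³`, and `β²H⁸·K₁ → 0` for every `θ < 1/10` (rows `8θ < 1`, `12θ < 3/2`). -/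
theorem rowBound_R1 : ∀ θ : ℝ, 0 < θ → θ < 1 / 10 → ∀ B : ℝ, ∀ Tc : ZdPlaquette 4 → Fin 4 → Fin 4 → Fin 4 → ℝ, (∀ p i j k, |Tc p i j k| ≤ B) →
    ∃ q : ℝ, ∃ K : ℝ → ℕ → ℝ,
      (∃ β₀ : ℝ, 1 ≤ β₀ ∧ ∀ β : ℝ, β₀ ≤ β → ∀ H : ℕ, 1 ≤ H → β ^ θ ≤ (H : ℝ) → (H : ℝ) ≤ β ^ θ + 1 →
        ∀ D : Set (LandauFree H → E3), MeasurableSet D → D ⊆ smallField H (β ^ ((1 / 8 - θ / 4) - 1 / 2)) → (∀ a, -a ∈ D ↔ a ∈ D) →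
        gaussAvg β H (fun a => 1 - D.indicator (fun _ => (1 : ℝ)) a) ≤ β ^ (-q) →
        gaussAvg β H (fun a => 1 - D.indicator (fun _ => (1 : ℝ)) a) ≤ 1 / 2 → (∀ a ∈ D, |tiltU β H a| ≤ 2) → ∀ x y : Site 4,
        |Tilt.tiltCum4 (((volume : Measure (LandauFree H → E3)).restrict D).withDensity fun a => ENNReal.ofReal (gaussWeight β H a))
            (fun a => β * ∑ p ∈ plaquettesTouching (boxEdges 4 (2 * H + 1)), tripleForm (Tc p) (plaqVar H p.1 p.2.1.1 p.2.1.2 a)) 0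
            (linCurvSq H (plaq12At x)) (linCurvSq H (plaq12At y))| ≤ K β H) ∧
      (∀ ε : ℝ, 0 < ε → ∃ β₀ : ℝ, 1 ≤ β₀ ∧ ∀ β : ℝ, β₀ ≤ β → ∀ H : ℕ, 1 ≤ H → (H : ℝ) ≤ β ^ θ + 1 → β ^ 2 * (H : ℝ) ^ 8 * K β H ≤ ε) := by
  intro θ hθ hθ' B Tc hTc
  obtain ⟨C, hC0, hR1⟩ := EdgeChartGaussian.abs_tiltCum4_muSet_cubicPair_le
  refine ⟨1, fun β H => C * B ^ 2 * (1 + Real.log H) ^ 7 * (1 + Real.sqrt (β ^ (-(1 : ℝ))) * (H : ℝ) ^ 4) / β ^ 3, ⟨2, by norm_num, ?_⟩, ?_⟩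
  · intro β hβ H hH _ _ D hDm hDs _ hco _ _ x y
    have hβ0 : 0 < β := by linarith
    have hτ2 : β ^ (-(1 : ℝ)) ≤ 1 / 2 := by
      rw [Real.rpow_neg_one]
      have h := inv_anti₀ (by norm_num : (0 : ℝ) < 2) hβ
      norm_num at h ⊢
      exact h
    exact hR1 H hH β hβ0 B Tc hTc x y _ (Real.rpow_nonneg hβ0.le _) D hDm hDs (β ^ (-(1 : ℝ))) hco hτ2
  · intro ε hε
    have hε' : 0 < ε / 2 := half_pos hε
    obtain h₁ := budget_monomial (a := -1) (k := 8) (j := 0) (κ₃ := 0) hθ.le (by push_cast; linarith) hε' (C * B ^ 2) 7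
    obtain h₂ := budget_monomial (a := -(3 / 2)) (k := 12) (j := 0) (κ₃ := 0) hθ.le (by push_cast; linarith) hε' (C * B ^ 2) 7
    obtain ⟨β₀, hβ₀, hall⟩ := exists_forall_and h₁ h₂
    refine ⟨β₀, hβ₀, fun β hβ H hH hHu => ?_⟩
    obtain ⟨e₁, e₂⟩ := hall β hβ H
    replace e₁ := e₁ hH hHu
    replace e₂ := e₂ hH hHu
    simp only [pow_zero, mul_one] at e₁ e₂
    have hβ0 : 0 < β := by linarith
    have hsq : Real.sqrt (β ^ (-(1 : ℝ))) = β ^ (-(1 / 2 : ℝ)) := by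
      rw [Real.sqrt_eq_rpow, ← Real.rpow_mul hβ0.le]; norm_num
    have hb3 : (β : ℝ) ^ 3 = β ^ (3 : ℝ) := by rw [← Real.rpow_natCast]; norm_num
    have hb2 : (β : ℝ) ^ 2 = β ^ (2 : ℝ) := by rw [← Real.rpow_natCast]; norm_num
    have hm1 : β ^ (-1 : ℝ) = β ^ (2 : ℝ) * (β ^ (3 : ℝ))⁻¹ := by
      rw [← Real.rpow_neg hβ0.le, ← Real.rpow_add hβ0]; norm_num
    have hm2 : β ^ (-(3 / 2) : ℝ) = β ^ (2 : ℝ) * (β ^ (-(1 / 2 : ℝ)) * (β ^ (3 : ℝ))⁻¹) := by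
      rw [← Real.rpow_neg hβ0.le, ← Real.rpow_add hβ0, ← Real.rpow_add hβ0]; norm_num
    have hid : β ^ 2 * (H : ℝ) ^ 8 * (C * B ^ 2 * (1 + Real.log H) ^ 7 * (1 + Real.sqrt (β ^ (-(1 : ℝ))) * (H : ℝ) ^ 4) / β ^ 3) =
        C * B ^ 2 * (H : ℝ) ^ 8 * (1 + Real.log H) ^ 7 * β ^ (-1 : ℝ) +
          C * B ^ 2 * (H : ℝ) ^ 12 * (1 + Real.log H) ^ 7 * β ^ (-(3 / 2) : ℝ) := by
      rw [hsq, hb3, hb2, div_eq_mul_inv, hm1, hm2]; ring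
    rw [hid]
    linarith

/-- ★ **Row R2 (the `Q`-slots against the cubic polynomial) in the per-row `hKk` currency**, from w5 g24's
✓`GaussNormalForm.abs_tiltCum4_muSet_rowR2_sum_le_rpow` at `κ₃ := 1/8 − θ/4 ≤ 1/5`: `q₂ := 0`, `K₂ β H := C·B²·H⁴·(1+log H)⁴·β^{−7/2+(3/2)κ₃}`;
budget row `12θ − 3/2 + (3/2)κ₃ < 0`, i.e. `93θ/8 < 21/16` — strict for every `θ < 1/10`. -/
theorem rowBound_R2 : ∀ θ : ℝ, 0 < θ → θ < 1 / 10 → ∀ B : ℝ, ∀ Tc : ZdPlaquette 4 → Fin 4 → Fin 4 → Fin 4 → ℝ, (∀ p i j k, |Tc p i j k| ≤ B) →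
    ∃ q : ℝ, ∃ K : ℝ → ℕ → ℝ,
      (∃ β₀ : ℝ, 1 ≤ β₀ ∧ ∀ β : ℝ, β₀ ≤ β → ∀ H : ℕ, 1 ≤ H → β ^ θ ≤ (H : ℝ) → (H : ℝ) ≤ β ^ θ + 1 →
        ∀ D : Set (LandauFree H → E3), MeasurableSet D → D ⊆ smallField H (β ^ ((1 / 8 - θ / 4) - 1 / 2)) → (∀ a, -a ∈ D ↔ a ∈ D) →
        gaussAvg β H (fun a => 1 - D.indicator (fun _ => (1 : ℝ)) a) ≤ β ^ (-q) →
        gaussAvg β H (fun a => 1 - D.indicator (fun _ => (1 : ℝ)) a) ≤ 1 / 2 → (∀ a ∈ D, |tiltU β H a| ≤ 2) → ∀ x y : Site 4,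
        |Tilt.tiltCum4 (((volume : Measure (LandauFree H → E3)).restrict D).withDensity fun a => ENNReal.ofReal (gaussWeight β H a))
            (fun a => β * ∑ p ∈ plaquettesTouching (boxEdges 4 (2 * H + 1)), tripleForm (Tc p) (plaqVar H p.1 p.2.1.1 p.2.1.2 a)) 0
            (fun a => chartPlaqCost H x 1 2 a - linCurvSq H (plaq12At x) a) (chartPlaqCost H y 1 2) +
         Tilt.tiltCum4 (((volume : Measure (LandauFree H → E3)).restrict D).withDensity fun a => ENNReal.ofReal (gaussWeight β H a))
            (fun a => β * ∑ p ∈ plaquettesTouching (boxEdges 4 (2 * H + 1)), tripleForm (Tc p) (plaqVar H p.1 p.2.1.1 p.2.1.2 a)) 0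
            (linCurvSq H (plaq12At x)) (fun a => chartPlaqCost H y 1 2 a - linCurvSq H (plaq12At y) a)| ≤ K β H) ∧
      (∀ ε : ℝ, 0 < ε → ∃ β₀ : ℝ, 1 ≤ β₀ ∧ ∀ β : ℝ, β₀ ≤ β → ∀ H : ℕ, 1 ≤ H → (H : ℝ) ≤ β ^ θ + 1 → β ^ 2 * (H : ℝ) ^ 8 * K β H ≤ ε) := by
  intro θ hθ hθ' B Tc hTc
  obtain ⟨C, hC0, hR2⟩ := GaussNormalForm.abs_tiltCum4_muSet_rowR2_sum_le_rpow (κ₃ := 1 / 8 - θ / 4) (by linarith)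
  refine ⟨0, fun β H => C * B ^ 2 * (H : ℝ) ^ 4 * (1 + Real.log H) ^ 4 * β ^ (-7 / 2 + 3 / 2 * (1 / 8 - θ / 4)), ⟨1, le_rfl, ?_⟩, ?_⟩
  · intro β hβ H hH _ _ D hDm hDs _ _ hco2 _ x y
    have hDs' : D ⊆ smallField H (β ^ (-1 / 2 + (1 / 8 - θ / 4))) := by
      rwa [show (-1 / 2 + (1 / 8 - θ / 4) : ℝ) = (1 / 8 - θ / 4) - 1 / 2 by ring]
    exact hR2 H hH β hβ B Tc hTc D hDm hDs' (1 / 2) hco2 le_rfl x y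
  · intro ε hε
    obtain ⟨β₀, hβ₀, h⟩ := budget_monomial (a := 2 + (-7 / 2 + 3 / 2 * (1 / 8 - θ / 4))) (k := 12) (j := 0) (κ₃ := 0) hθ.le
      (by push_cast; linarith) hε (C * B ^ 2) 4
    refine ⟨β₀, hβ₀, fun β hβ H hH hHu => ?_⟩
    have e := h β hβ H hH hHu
    simp only [pow_zero, mul_one] at e
    have hβ0 : 0 < β := by linarith
    have hid : β ^ 2 * (H : ℝ) ^ 8 * (C * B ^ 2 * (H : ℝ) ^ 4 * (1 + Real.log H) ^ 4 * β ^ (-7 / 2 + 3 / 2 * (1 / 8 - θ / 4))) =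
        C * B ^ 2 * (H : ℝ) ^ 12 * (1 + Real.log H) ^ 4 * β ^ (2 + (-7 / 2 + 3 / 2 * (1 / 8 - θ / 4))) := by
      have h2 : β ^ (2 + (-7 / 2 + 3 / 2 * (1 / 8 - θ / 4))) = β ^ 2 * β ^ (-7 / 2 + 3 / 2 * (1 / 8 - θ / 4)) := by
        rw [Real.rpow_add hβ0, Real.rpow_two]
      rw [h2]; ring
    rw [hid]
    exact e

/-- ★ **Row R5 (the even-tilt slot) in the per-row `hKk` currency**, from ✓`GaussNormalForm.abs_tiltCum4_muSet_chartPlaqCost_tiltUEven_le` (LEAD g78):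
`q₅ := 0` (no co-mass demand), `K₅ β H := C·(1+log H)^m·s⁴·(H⁸/β² + H¹²s⁶ + H⁸s⁸)` at `s = β^{(1/8−θ/4)−1/2}`; the side conditions `H⁴ ≤ β`, `s·H² ≤ c₀`,
`s ≤ 1` by ✓`side_budget`; `β²H⁸·K₅ → 0` for every `θ < 1/10` (rows `15θ < 3/2` (K6), `35θ/2 < 7/4`, `13θ < 5/2` — all strict exactly on `θ < 1/10`). -/
theorem rowBound_R5 : ∀ θ : ℝ, 0 < θ → θ < 1 / 10 → ∃ q : ℝ, ∃ K : ℝ → ℕ → ℝ,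
      (∃ β₀ : ℝ, 1 ≤ β₀ ∧ ∀ β : ℝ, β₀ ≤ β → ∀ H : ℕ, 1 ≤ H → β ^ θ ≤ (H : ℝ) → (H : ℝ) ≤ β ^ θ + 1 →
        ∀ D : Set (LandauFree H → E3), MeasurableSet D → D ⊆ smallField H (β ^ ((1 / 8 - θ / 4) - 1 / 2)) → (∀ a, -a ∈ D ↔ a ∈ D) →
        gaussAvg β H (fun a => 1 - D.indicator (fun _ => (1 : ℝ)) a) ≤ β ^ (-q) →
        gaussAvg β H (fun a => 1 - D.indicator (fun _ => (1 : ℝ)) a) ≤ 1 / 2 → (∀ a ∈ D, |tiltU β H a| ≤ 2) → ∀ x y : Site 4,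
        |Tilt.tiltCum4 (((volume : Measure (LandauFree H → E3)).restrict D).withDensity fun a => ENNReal.ofReal (gaussWeight β H a))
            (fun a => (tiltU β H a + tiltU β H (-a)) / 2) 0 (chartPlaqCost H x 1 2) (chartPlaqCost H y 1 2)| ≤ K β H) ∧
      (∀ ε : ℝ, 0 < ε → ∃ β₀ : ℝ, 1 ≤ β₀ ∧ ∀ β : ℝ, β₀ ≤ β → ∀ H : ℕ, 1 ≤ H → (H : ℝ) ≤ β ^ θ + 1 → β ^ 2 * (H : ℝ) ^ 8 * K β H ≤ ε) := by
  intro θ hθ hθ'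
  obtain ⟨C, c₀, m, hC0, hc₀, hR5⟩ := GaussNormalForm.abs_tiltCum4_muSet_chartPlaqCost_tiltUEven_le
  obtain ⟨b₀, hb₀, hside⟩ := side_budget (κ₃ := 1 / 8 - θ / 4) (c := c₀) hθ (by linarith) (by linarith) hc₀ 0
  refine ⟨0, fun β H => C * (1 + Real.log H) ^ m * (β ^ ((1 / 8 - θ / 4) - 1 / 2)) ^ 4 *
      ((H : ℝ) ^ 8 / β ^ 2 + (H : ℝ) ^ 12 * (β ^ ((1 / 8 - θ / 4) - 1 / 2)) ^ 6 + (H : ℝ) ^ 8 * (β ^ ((1 / 8 - θ / 4) - 1 / 2)) ^ 8),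
    ⟨b₀, hb₀, ?_⟩, ?_⟩
  · intro β hβ H hH hHl hHu D hDm hDs hsym _ hco2 hU x y
    obtain ⟨hH4, hsH, -, -, hs1⟩ := hside β hβ H hH hHl hHu
    have hβ0 : 0 < β := by linarith
    exact hR5 H hH β hH4 _ (Real.rpow_nonneg hβ0.le _) hs1 hsH D hDm hDs hsym 2 (by norm_num) hU (1 / 2) hco2 le_rfl x y
  · intro ε hε
    have hε' : 0 < ε / 3 := by positivity
    obtain h₁ := budget_monomial (a := 0) (k := 16) (j := 4) (κ₃ := 1 / 8 - θ / 4) hθ.le (by push_cast; linarith) hε' C m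
    obtain h₂ := budget_monomial (a := 2) (k := 20) (j := 10) (κ₃ := 1 / 8 - θ / 4) hθ.le (by push_cast; linarith) hε' C m
    obtain h₃ := budget_monomial (a := 2) (k := 16) (j := 12) (κ₃ := 1 / 8 - θ / 4) hθ.le (by push_cast; linarith) hε' C m
    obtain ⟨β₀, hβ₀, hall⟩ := exists_forall_and h₁ (exists_forall_and h₂ h₃)
    refine ⟨β₀, hβ₀, fun β hβ H hH hHu => ?_⟩
    obtain ⟨e₁, e₂, e₃⟩ := hall β hβ H
    replace e₁ := e₁ hH hHu
    replace e₂ := e₂ hH hHu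
    replace e₃ := e₃ hH hHu
    have hβ0 : 0 < β := by linarith
    simp only [Real.rpow_zero, mul_one, Real.rpow_two] at e₁ e₂ e₃
    set s : ℝ := β ^ ((1 / 8 - θ / 4) - 1 / 2) with hs
    have hid : β ^ 2 * (H : ℝ) ^ 8 * (C * (1 + Real.log H) ^ m * s ^ 4 * ((H : ℝ) ^ 8 / β ^ 2 + (H : ℝ) ^ 12 * s ^ 6 + (H : ℝ) ^ 8 * s ^ 8)) =
        C * (H : ℝ) ^ 16 * (1 + Real.log H) ^ m * s ^ 4 + C * (H : ℝ) ^ 20 * (1 + Real.log H) ^ m * s ^ 10 * β ^ 2 +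
          C * (H : ℝ) ^ 16 * (1 + Real.log H) ^ m * s ^ 12 * β ^ 2 := by
      field_simp
    rw [hid]
    linarith

end K4RowSum

/-! ## The row sum -/

open K4RowSum ErrorBudget in
/-- ★★ **`hK4` OF ✓`landauThirdOrder_of_sizes₂` AS THE SUM OF THE K4′ ROWS.**  Hypotheses (each for every `0 < θ < 1/10`, in the per-row `hKk` currency
— bound `Kᵢ β H` on every admissible symmetric cut set at the point of record with co-mass demand `qᵢ`, and `β²H⁸·Kᵢ → 0` on the top slab):
`hR3`, `hR4` = w2's rows for the record `Tc` (bounded, with `|cubicVertex + P| ≤ Cr·β·H⁴·s⁵` on small fields); `hR67` = the Uᵒ/Uᵉ CROSS row (LEAD).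
The composition `|κ₄(c_x,c_y;tiltU)| ≤ R1 + |R2a + R2b| + R3 + 2·R4 + R5 + 2·R67` is LEAD's ✓`GaussNormalForm.abs_tiltCum4_muSet_tiltU_le_rows` by name;
R1, R2 and R5 are discharged by name (`rowBound_R1`, `rowBound_R2`, `rowBound_R5`).  Conclusion: w2 g33's `hK4`
VERBATIM (`q := max qᵢ`, `K := K₁+K₂+K₃+2K₄+K₅+2K₆₇`). -/
theorem tiltCum4_cutSet_size_of_rows
    (hR3 : ∀ θ : ℝ, 0 < θ → θ < 1 / 10 → ∀ B Cr : ℝ, ∀ Tc : ZdPlaquette 4 → Fin 4 → Fin 4 → Fin 4 → ℝ, (∀ p i j k, |Tc p i j k| ≤ B) →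
      (∀ H : ℕ, 1 ≤ H → ∀ β : ℝ, 0 < β → ∀ s : ℝ, 0 ≤ s → ∀ a ∈ smallField H s,
        |cubicVertex β H a + β * ∑ p ∈ plaquettesTouching (boxEdges 4 (2 * H + 1)), tripleForm (Tc p) (plaqVar H p.1 p.2.1.1 p.2.1.2 a)| ≤
          Cr * β * (H : ℝ) ^ 4 * s ^ 5) →
      ∃ q : ℝ, ∃ K : ℝ → ℕ → ℝ,
      (∃ β₀ : ℝ, 1 ≤ β₀ ∧ ∀ β : ℝ, β₀ ≤ β → ∀ H : ℕ, 1 ≤ H → β ^ θ ≤ (H : ℝ) → (H : ℝ) ≤ β ^ θ + 1 →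
        ∀ D : Set (LandauFree H → E3), MeasurableSet D → D ⊆ smallField H (β ^ ((1 / 8 - θ / 4) - 1 / 2)) → (∀ a, -a ∈ D ↔ a ∈ D) →
        gaussAvg β H (fun a => 1 - D.indicator (fun _ => (1 : ℝ)) a) ≤ β ^ (-q) →
        gaussAvg β H (fun a => 1 - D.indicator (fun _ => (1 : ℝ)) a) ≤ 1 / 2 → (∀ a ∈ D, |tiltU β H a| ≤ 2) → ∀ x y : Site 4,
        |Tilt.tiltCum4 (((volume : Measure (LandauFree H → E3)).restrict D).withDensity fun a => ENNReal.ofReal (gaussWeight β H a))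
            (fun a => (tiltU β H a - tiltU β H (-a)) / 2 -
              β * ∑ p ∈ plaquettesTouching (boxEdges 4 (2 * H + 1)), tripleForm (Tc p) (plaqVar H p.1 p.2.1.1 p.2.1.2 a)) 0
            (chartPlaqCost H x 1 2) (chartPlaqCost H y 1 2)| ≤ K β H) ∧
      (∀ ε : ℝ, 0 < ε → ∃ β₀ : ℝ, 1 ≤ β₀ ∧ ∀ β : ℝ, β₀ ≤ β → ∀ H : ℕ, 1 ≤ H → (H : ℝ) ≤ β ^ θ + 1 → β ^ 2 * (H : ℝ) ^ 8 * K β H ≤ ε))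
    (hR4 : ∀ θ : ℝ, 0 < θ → θ < 1 / 10 → ∀ B Cr : ℝ, ∀ Tc : ZdPlaquette 4 → Fin 4 → Fin 4 → Fin 4 → ℝ, (∀ p i j k, |Tc p i j k| ≤ B) →
      (∀ H : ℕ, 1 ≤ H → ∀ β : ℝ, 0 < β → ∀ s : ℝ, 0 ≤ s → ∀ a ∈ smallField H s,
        |cubicVertex β H a + β * ∑ p ∈ plaquettesTouching (boxEdges 4 (2 * H + 1)), tripleForm (Tc p) (plaqVar H p.1 p.2.1.1 p.2.1.2 a)| ≤
          Cr * β * (H : ℝ) ^ 4 * s ^ 5) →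
      ∃ q : ℝ, ∃ K : ℝ → ℕ → ℝ,
      (∃ β₀ : ℝ, 1 ≤ β₀ ∧ ∀ β : ℝ, β₀ ≤ β → ∀ H : ℕ, 1 ≤ H → β ^ θ ≤ (H : ℝ) → (H : ℝ) ≤ β ^ θ + 1 →
        ∀ D : Set (LandauFree H → E3), MeasurableSet D → D ⊆ smallField H (β ^ ((1 / 8 - θ / 4) - 1 / 2)) → (∀ a, -a ∈ D ↔ a ∈ D) →
        gaussAvg β H (fun a => 1 - D.indicator (fun _ => (1 : ℝ)) a) ≤ β ^ (-q) →
        gaussAvg β H (fun a => 1 - D.indicator (fun _ => (1 : ℝ)) a) ≤ 1 / 2 → (∀ a ∈ D, |tiltU β H a| ≤ 2) → ∀ x y : Site 4,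
        let μD : Measure (LandauFree H → E3) := ((volume : Measure (LandauFree H → E3)).restrict D).withDensity fun a => ENNReal.ofReal (gaussWeight β H a)
        let P : (LandauFree H → E3) → ℝ := fun a => β * ∑ p ∈ plaquettesTouching (boxEdges 4 (2 * H + 1)), tripleForm (Tc p) (plaqVar H p.1 p.2.1.1 p.2.1.2 a)
        let N : (LandauFree H → E3) → ℝ := fun a => (tiltU β H a - tiltU β H (-a)) / 2 - P a
        let X : (LandauFree H → E3) → ℝ := chartPlaqCost H x 1 2
        let Y : (LandauFree H → E3) → ℝ := chartPlaqCost H y 1 2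
        let EP : ((LandauFree H → E3) → ℝ) → ℝ := fun G => Tilt.tiltExp μD P 0 G
        |EP (fun a => (X a - EP X) * (Y a - EP Y) * (P a - EP P) * (N a - EP N)) - EP (fun a => (X a - EP X) * (Y a - EP Y)) * EP (fun a => (P a - EP P) * (N a - EP N))
            - EP (fun a => (X a - EP X) * (P a - EP P)) * EP (fun a => (Y a - EP Y) * (N a - EP N))
            - EP (fun a => (X a - EP X) * (N a - EP N)) * EP (fun a => (Y a - EP Y) * (P a - EP P))| ≤ K β H) ∧
      (∀ ε : ℝ, 0 < ε → ∃ β₀ : ℝ, 1 ≤ β₀ ∧ ∀ β : ℝ, β₀ ≤ β → ∀ H : ℕ, 1 ≤ H → (H : ℝ) ≤ β ^ θ + 1 → β ^ 2 * (H : ℝ) ^ 8 * K β H ≤ ε))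
    (hR67 : ∀ θ : ℝ, 0 < θ → θ < 1 / 10 → ∃ q : ℝ, ∃ K : ℝ → ℕ → ℝ,
      (∃ β₀ : ℝ, 1 ≤ β₀ ∧ ∀ β : ℝ, β₀ ≤ β → ∀ H : ℕ, 1 ≤ H → β ^ θ ≤ (H : ℝ) → (H : ℝ) ≤ β ^ θ + 1 →
        ∀ D : Set (LandauFree H → E3), MeasurableSet D → D ⊆ smallField H (β ^ ((1 / 8 - θ / 4) - 1 / 2)) → (∀ a, -a ∈ D ↔ a ∈ D) →
        gaussAvg β H (fun a => 1 - D.indicator (fun _ => (1 : ℝ)) a) ≤ β ^ (-q) →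
        gaussAvg β H (fun a => 1 - D.indicator (fun _ => (1 : ℝ)) a) ≤ 1 / 2 → (∀ a ∈ D, |tiltU β H a| ≤ 2) → ∀ x y : Site 4,
        let μD : Measure (LandauFree H → E3) := ((volume : Measure (LandauFree H → E3)).restrict D).withDensity fun a => ENNReal.ofReal (gaussWeight β H a)
        let Uo : (LandauFree H → E3) → ℝ := fun a => (tiltU β H a - tiltU β H (-a)) / 2
        let Ue : (LandauFree H → E3) → ℝ := fun a => (tiltU β H a + tiltU β H (-a)) / 2
        let X : (LandauFree H → E3) → ℝ := chartPlaqCost H x 1 2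
        let Y : (LandauFree H → E3) → ℝ := chartPlaqCost H y 1 2
        let EO : ((LandauFree H → E3) → ℝ) → ℝ := fun G => Tilt.tiltExp μD Uo 0 G
        |EO (fun a => (X a - EO X) * (Y a - EO Y) * (Uo a - EO Uo) * (Ue a - EO Ue)) - EO (fun a => (X a - EO X) * (Y a - EO Y)) * EO (fun a => (Uo a - EO Uo) * (Ue a - EO Ue))
            - EO (fun a => (X a - EO X) * (Uo a - EO Uo)) * EO (fun a => (Y a - EO Y) * (Ue a - EO Ue))
            - EO (fun a => (X a - EO X) * (Ue a - EO Ue)) * EO (fun a => (Y a - EO Y) * (Uo a - EO Uo))| ≤ K β H) ∧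
      (∀ ε : ℝ, 0 < ε → ∃ β₀ : ℝ, 1 ≤ β₀ ∧ ∀ β : ℝ, β₀ ≤ β → ∀ H : ℕ, 1 ≤ H → (H : ℝ) ≤ β ^ θ + 1 → β ^ 2 * (H : ℝ) ^ 8 * K β H ≤ ε)) :
    ∀ θ : ℝ, 0 < θ → θ < 1 / 10 → ∃ q : ℝ, ∃ K : ℝ → ℕ → ℝ,
      (∃ β₀ : ℝ, 1 ≤ β₀ ∧ ∀ β : ℝ, β₀ ≤ β → ∀ H : ℕ, 1 ≤ H → β ^ θ ≤ (H : ℝ) → (H : ℝ) ≤ β ^ θ + 1 →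
        ∀ D : Set (LandauFree H → E3), MeasurableSet D → D ⊆ smallField H (β ^ ((1 / 8 - θ / 4) - 1 / 2)) → (∀ a, -a ∈ D ↔ a ∈ D) →
        gaussAvg β H (fun a => 1 - D.indicator (fun _ => (1 : ℝ)) a) ≤ β ^ (-q) →
        gaussAvg β H (fun a => 1 - D.indicator (fun _ => (1 : ℝ)) a) ≤ 1 / 2 → (∀ a ∈ D, |tiltU β H a| ≤ 2) → ∀ x y : Site 4,
        |Tilt.tiltCum4 (((volume : Measure (LandauFree H → E3)).restrict D).withDensity fun a => ENNReal.ofReal (gaussWeight β H a))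
            (tiltU β H) 0 (chartPlaqCost H x 1 2) (chartPlaqCost H y 1 2)| ≤ K β H) ∧
      (∀ ε : ℝ, 0 < ε → ∃ β₀ : ℝ, 1 ≤ β₀ ∧ ∀ β : ℝ, β₀ ≤ β → ∀ H : ℕ, 1 ≤ H → (H : ℝ) ≤ β ^ θ + 1 → β ^ 2 * (H : ℝ) ^ 8 * K β H ≤ ε) := by
  intro θ hθ hθ'
  -- the record coefficients and the seven rows at this `θ`
  obtain ⟨B, Cr, -, -, Tc, hTc, hrem⟩ := exists_tripleCoeff_record
  obtain ⟨q₁, K₁, hB₁, hS₁⟩ := rowBound_R1 θ hθ hθ' B Tc hTc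
  obtain ⟨q₂, K₂, hB₂, hS₂⟩ := rowBound_R2 θ hθ hθ' B Tc hTc
  obtain ⟨q₃, K₃, hB₃, hS₃⟩ := hR3 θ hθ hθ' B Cr Tc hTc hrem
  obtain ⟨q₄, K₄, hB₄, hS₄⟩ := hR4 θ hθ hθ' B Cr Tc hTc hrem
  obtain ⟨q₅, K₅, hB₅, hS₅⟩ := rowBound_R5 θ hθ hθ'
  obtain ⟨q₆, K₆, hB₆, hS₆⟩ := hR67 θ hθ hθ'
  set q : ℝ := max (max (max q₁ q₂) (max q₃ q₄)) (max q₅ q₆) with hqdef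
  have hq₁ : q₁ ≤ q := (le_max_left _ _).trans ((le_max_left _ _).trans (le_max_left _ _))
  have hq₂ : q₂ ≤ q := (le_max_right _ _).trans ((le_max_left _ _).trans (le_max_left _ _))
  have hq₃ : q₃ ≤ q := (le_max_left _ _).trans ((le_max_right _ _).trans (le_max_left _ _))
  have hq₄ : q₄ ≤ q := (le_max_right _ _).trans ((le_max_right _ _).trans (le_max_left _ _))
  have hq₅ : q₅ ≤ q := (le_max_left _ _).trans (le_max_right _ _)
  have hq₆ : q₆ ≤ q := (le_max_right _ _).trans (le_max_right _ _)
  refine ⟨q, fun β H => K₁ β H + K₂ β H + K₃ β H + 2 * K₄ β H + K₅ β H + 2 * K₆ β H, ?_, ?_⟩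
  · -- the bound on every admissible cut set
    obtain ⟨β₀, hβ₀, hall⟩ := exists_forall_and hB₁ (exists_forall_and hB₂ (exists_forall_and hB₃ (exists_forall_and hB₄ (exists_forall_and hB₅ hB₆))))
    refine ⟨β₀, hβ₀, fun β hβ H hH hHl hHu D hDm hDs hsym hco hco2 hU x y => ?_⟩
    obtain ⟨r₁, r₂, r₃, r₄, r₅, r₆⟩ := hall β hβ H
    have hβ1 : 1 ≤ β := hβ₀.trans hβ
    have hβ0 : 0 < β := by linarith
    have hmono : ∀ {q' : ℝ}, q' ≤ q → gaussAvg β H (fun a => 1 - D.indicator (fun _ => (1 : ℝ)) a) ≤ β ^ (-q') :=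
      fun hq' => hco.trans (Real.rpow_le_rpow_of_exponent_le hβ1 (neg_le_neg hq'))
    replace r₁ := r₁ hH hHl hHu D hDm hDs hsym (hmono hq₁) hco2 hU x y
    replace r₂ := r₂ hH hHl hHu D hDm hDs hsym (hmono hq₂) hco2 hU x y
    replace r₃ := r₃ hH hHl hHu D hDm hDs hsym (hmono hq₃) hco2 hU x y
    replace r₄ := r₄ hH hHl hHu D hDm hDs hsym (hmono hq₄) hco2 hU x y
    replace r₅ := r₅ hH hHl hHu D hDm hDs hsym (hmono hq₅) hco2 hU x y
    replace r₆ := r₆ hH hHl hHu D hDm hDs hsym (hmono hq₆) hco2 hU x y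
    have hs0 : 0 ≤ β ^ ((1 / 8 - θ / 4) - 1 / 2) := Real.rpow_nonneg hβ0.le _
    have hs1 : β ^ ((1 / 8 - θ / 4) - 1 / 2) ≤ 1 := Real.rpow_le_one_of_one_le_of_nonpos hβ1 (by linarith)
    -- LEAD g78's composition (S1)∘(S2)∘(S3), by name
    have hsp := GaussNormalForm.abs_tiltCum4_muSet_tiltU_le_rows H hβ0 hs0 hs1 B Tc hTc hDm hDs hsym (by norm_num : (0 : ℝ) ≤ 2) hU hco2 le_rfl x y
    dsimp only at hsp r₄ r₆
    have key : ∀ {t a₁ a₂ a₃ a₄ a₅ a₆ k₁ k₂ k₃ k₄ k₅ k₆ : ℝ}, t ≤ a₁ + a₂ + a₃ + 2 * a₄ + a₅ + 2 * a₆ →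
        a₁ ≤ k₁ → a₂ ≤ k₂ → a₃ ≤ k₃ → a₄ ≤ k₄ → a₅ ≤ k₅ → a₆ ≤ k₆ → t ≤ k₁ + k₂ + k₃ + 2 * k₄ + k₅ + 2 * k₆ := by
      intros; linarith
    exact key hsp r₁ r₂ r₃ r₄ r₅ r₆
  · -- the budget
    intro ε hε
    have hε' : 0 < ε / 8 := by positivity
    obtain ⟨β₀, hβ₀, hall⟩ := exists_forall_and (hS₁ _ hε') (exists_forall_and (hS₂ _ hε') (exists_forall_and (hS₃ _ hε')
      (exists_forall_and (hS₄ _ hε') (exists_forall_and (hS₅ _ hε') (hS₆ _ hε')))))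
    refine ⟨β₀, hβ₀, fun β hβ H hH hHu => ?_⟩
    obtain ⟨e₁, e₂, e₃, e₄, e₅, e₆⟩ := hall β hβ H
    replace e₁ := e₁ hH hHu
    replace e₂ := e₂ hH hHu
    replace e₃ := e₃ hH hHu
    replace e₄ := e₄ hH hHu
    replace e₅ := e₅ hH hHu
    replace e₆ := e₆ hH hHu
    have hid : β ^ 2 * (H : ℝ) ^ 8 * (K₁ β H + K₂ β H + K₃ β H + 2 * K₄ β H + K₅ β H + 2 * K₆ β H) =
        β ^ 2 * (H : ℝ) ^ 8 * K₁ β H + β ^ 2 * (H : ℝ) ^ 8 * K₂ β H + β ^ 2 * (H : ℝ) ^ 8 * K₃ β H + 2 * (β ^ 2 * (H : ℝ) ^ 8 * K₄ β H) +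
          β ^ 2 * (H : ℝ) ^ 8 * K₅ β H + 2 * (β ^ 2 * (H : ℝ) ^ 8 * K₆ β H) := by ring
    rw [hid]
    linarith

end Summit.QuantumFields.YangMills.Theorems.AllWindowsColdBoxBoxHighLine
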